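import Mathlib
import HarnessLib
import Literature.Analysis.FluidPDE.ClassicalSolution
import Literature.Analysis.FluidPDE.VectorCalculus
import Literature.Analysis.FluidPDE.VectorCalculusProofs
import Literature.Analysis.FluidPDE.Vorticity
import Literature.Analysis.FluidPDE.VorticityEquation
import Literature.Analysis.FluidPDE.WholeSpaceIBP
import Literature.Analysis.FluidPDE.SpaceTimeCalculus
import Literature.Analysis.FluidPDE.VeryWeakToDistributional
import Literature.Analysis.FluidPDE.SelfSimilar
import Summits.NavierStokesRegularity.NavierStokesRegularity.Theorems.ChiralWindowDoorClassDerivDecay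

/-!
# Route `HalfSpaceWindowDoor`, crux `CirculationCarryingRigidity` (stmt-NavierStokesRegularity-25311) — the WINDOWED
# DIRECTIONAL-VORTICITY BALANCE LAW (the "windowed Kelvin law" of the line, as an exact identity)

For a classical solution `(u, p)` of the unforced Navier–Stokes equations (viscosity `ν`) on an OPEN time set `S`, a fixed
direction `e ∈ ℝ³` and a test function `φ ∈ C_c^∞(ℝ³)`, the windowed `e`-circulation obeys, at every `t ∈ S`,

  `d/dt ∫ φ ⟪ω, e⟫ = ν ∫ (Δφ) ⟪ω, e⟫ + ∫ ⟪ω, e⟫ (∇φ·u) − ∫ ⟪u, e⟫ (∇φ·ω)`,   `ω = curl u`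

(`hasDerivAt_integral_mul_inner_curl`).  Mechanism (Majda–Bertozzi 2002, Prop. 2.4 eq. (2.110), tested): the
`e`-component of the vorticity equation is a CONSERVATION LAW,

  `∂ₜ⟪ω, e⟫ = νΔ⟪ω, e⟫ + div(⟪u, e⟫ ω − ⟪ω, e⟫ u)`   (`inner_convect_sub_eq_divergence`: `⟪(ω·∇)u − (u·∇)ω, e⟫ =
  div(⟪u,e⟫ω − ⟪ω,e⟫u)` for `div u = div ω = 0`; the flux `⟪u,e⟫ω − ⟪ω,e⟫u` has identically vanishing `e`-component),

tested against `φ` (differentiation under the integral on the support of `φ`, `hasDerivAt_integral_of_support_subset`),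
one integration by parts for the flux (`integral_mul_divergence_add_eq_zero_left`) and Green's second identity for the
viscous term (`integral_inner_laplacian_add_eq_zero` twice).  This is the identity behind the route's informal "plane-flux
heat law" (with `φ → 1_{x₃ ∈ I}`-type weights the flux term is what must be controlled) and behind the `WindowedFluxDecay`
bookkeeping; the tree's helicity twin is `IsClassicalNSSolutionOn.hasDerivAt_integral_mul_helicityDensity`.

* `hasDerivAt_integral_mul_inner_curl` — the law for classical solutions on open time sets (any `ν`, any `e`);
* `hasDerivAt_integral_mul_inner_curl_of_class` — the law for every profile of the door's Type-I ancient Oseen-mild class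
  (`ν = 1`, `S = (−∞,0)`; the class is classical, `…ChiralWindowDoorClassDerivDecay.exists_classical_of_class`).

Seat ns-hsw-p1 g2 (LEAD of 25311, cell pub-ns-dss).  WHAT THIS IS NOT: no estimate and no statement about Navier–Stokes
regularity — an exact identity for smooth solutions (door statements concern HYPOTHETICAL blow-up profiles); helper
`--supports` 25311.
-/

noncomputable section

-- the summit and its single sub-problem share the name (CONVENTIONS §1), as in every Theorems file
set_option linter.dupNamespace false

namespace Summit.NavierStokesRegularity.NavierStokesRegularity.Theorems.HalfSpaceWindowDoorCirculationCarryingRigidityVorticityBalance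

open MeasureTheory Set Function Filter InnerProductSpace
open scoped RealInnerProductSpace Topology Laplacian ContDiff
open Literature.Analysis Literature.Analysis.FluidPDE
open Summit.NavierStokesRegularity.NavierStokesRegularity.Theorems.ChiralWindowDoorClassDerivDecay (exists_classical_of_class)

variable {S : Set ℝ} {ν : ℝ} {u : ℝ → EuclideanSpace ℝ (Fin 3) → EuclideanSpace ℝ (Fin 3)}
  {p : ℝ → EuclideanSpace ℝ (Fin 3) → ℝ}

/-! ### The `e`-component of transport-minus-stretching is a divergence -/

/-- **`⟪(ω·∇)u − (u·∇)ω, e⟫ = div(⟪u,e⟫ ω − ⟪ω,e⟫ u)`** at a point, for `C¹` fields `u, ω` with `div u(x) = div ω(x) = 0`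
(Leibniz: `div(f W) = Df[W] + f div W`). [cite: MajdaBertozziCUP2002, Prop. 2.4 eq. (2.110); folklore] -/
theorem inner_convect_sub_eq_divergence {U W : EuclideanSpace ℝ (Fin 3) → EuclideanSpace ℝ (Fin 3)}
    {x : EuclideanSpace ℝ (Fin 3)} (hU : DifferentiableAt ℝ U x) (hW : DifferentiableAt ℝ W x)
    (hdivU : VectorCalculus.divergence U x = 0) (hdivW : VectorCalculus.divergence W x = 0) (e : EuclideanSpace ℝ (Fin 3)) :
    ⟪convect W U x, e⟫ - ⟪convect U W x, e⟫ =
      VectorCalculus.divergence (fun y => ⟪U y, e⟫ • W y - ⟪W y, e⟫ • U y) x := by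
  have hfU : DifferentiableAt ℝ (fun y => ⟪U y, e⟫) x := hU.inner ℝ (differentiableAt_const e)
  have hfW : DifferentiableAt ℝ (fun y => ⟪W y, e⟫) x := hW.inner ℝ (differentiableAt_const e)
  have h1 : VectorCalculus.divergence (fun y => ⟪U y, e⟫ • W y) x = ⟪fderiv ℝ U x (W x), e⟫ := by
    rw [divergence_smul_apply hfU hW, hdivW, mul_zero, zero_add, real_inner_comm, gradient,
      InnerProductSpace.toDual_symm_apply, fderiv_inner_apply ℝ hU (differentiableAt_const e)]
    simp
  have h2 : VectorCalculus.divergence (fun y => ⟪W y, e⟫ • U y) x = ⟪fderiv ℝ W x (U x), e⟫ := by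
    rw [divergence_smul_apply hfW hU, hdivU, mul_zero, zero_add, real_inner_comm, gradient,
      InnerProductSpace.toDual_symm_apply, fderiv_inner_apply ℝ hW (differentiableAt_const e)]
    simp
  have hd1 : DifferentiableAt ℝ (fun y => ⟪U y, e⟫ • W y) x := hfU.smul hW
  have hd2 : DifferentiableAt ℝ (fun y => ⟪W y, e⟫ • U y) x := hfW.smul hU
  have hsub : VectorCalculus.divergence (fun y => ⟪U y, e⟫ • W y - ⟪W y, e⟫ • U y) x =
      VectorCalculus.divergence (fun y => ⟪U y, e⟫ • W y) x - VectorCalculus.divergence (fun y => ⟪W y, e⟫ • U y) x := by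
    simp only [VectorCalculus.divergence]
    rw [show (fun y => ⟪U y, e⟫ • W y - ⟪W y, e⟫ • U y) = (fun y => ⟪U y, e⟫ • W y) - fun y => ⟪W y, e⟫ • U y from rfl,
      fderiv_sub hd1 hd2]
    simp
  rw [hsub, h1, h2, convect_apply, convect_apply]

/-! ### Green's second identity against a test function -/

/-- **`∫ φ ⟪ΔW, e⟫ = ∫ (Δφ) ⟪W, e⟫`** for `W ∈ C²(ℝ³; ℝ³)`, `φ ∈ C_c^∞(ℝ³)` and a fixed `e` (Green's first identity without
boundary, twice, for the pair `φ • e`, `W`). [cite: Leray1934, §6 (1.11) p. 203; folklore] -/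
theorem integral_mul_inner_laplacian_eq {W : EuclideanSpace ℝ (Fin 3) → EuclideanSpace ℝ (Fin 3)} (hW : ContDiff ℝ 2 W)
    {φ : EuclideanSpace ℝ (Fin 3) → ℝ} (hφ : ContDiff ℝ 2 φ) (hφc : HasCompactSupport φ) (e : EuclideanSpace ℝ (Fin 3)) :
    ∫ x, φ x * ⟪(Δ W) x, e⟫ = ∫ x, (Δ φ) x * ⟪W x, e⟫ := by
  set b := EuclideanSpace.basisFun (Fin 3) ℝ
  set v : EuclideanSpace ℝ (Fin 3) → EuclideanSpace ℝ (Fin 3) := fun x => φ x • e with hv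
  have hv2 : ContDiff ℝ 2 v := hφ.smul contDiff_const
  have hvc : HasCompactSupport v := hφc.smul_right (f' := fun _ : EuclideanSpace ℝ (Fin 3) => e)
  have hG1 := integral_inner_laplacian_add_eq_zero b hv2 (hW.of_le one_le_two) (Or.inl hvc)
  have hG2 := integral_inner_laplacian_add_eq_zero b hW (hv2.of_le one_le_two) (Or.inr hvc)
  have hsym : ∑ i, ∫ x, ⟪fderiv ℝ v x (b i), fderiv ℝ W x (b i)⟫ =
      ∑ i, ∫ x, ⟪fderiv ℝ W x (b i), fderiv ℝ v x (b i)⟫ := by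
    refine Finset.sum_congr rfl fun i _ => integral_congr_ae (Eventually.of_forall fun x => real_inner_comm _ _)
  have hkey : ∫ x, ⟪(Δ v) x, W x⟫ = ∫ x, ⟪(Δ W) x, v x⟫ := by linarith
  have hΔv : ∀ x, (Δ v) x = (Δ φ) x • e := fun x => laplacian_smul_const_right hφ e x
  calc ∫ x, φ x * ⟪(Δ W) x, e⟫ = ∫ x, ⟪(Δ W) x, v x⟫ := by
        refine integral_congr_ae (Eventually.of_forall fun x => ?_)
        simp only [hv, inner_smul_right]
    _ = ∫ x, ⟪(Δ v) x, W x⟫ := hkey.symm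
    _ = ∫ x, (Δ φ) x * ⟪W x, e⟫ := by
        refine integral_congr_ae (Eventually.of_forall fun x => ?_)
        beta_reduce
        rw [hΔv, real_inner_smul_left, real_inner_comm (W x) e]

/-! ### The balance law -/

/-- **WINDOWED DIRECTIONAL-VORTICITY BALANCE LAW.**  Let `(u, p)` be a classical solution of the unforced Navier–Stokes
equations with viscosity `ν` on an open time set `S` (`IsClassicalNSSolutionOn S ν 0 u p`), `t ∈ S`, `e ∈ ℝ³`, and
`φ ∈ C_c^∞(ℝ³)`.  Then, with `ω = curl u`,
`d/dt ∫ φ ⟪ω, e⟫ = ν ∫ (Δφ) ⟪ω, e⟫ + ∫ ⟪ω, e⟫ Dφ[u] − ∫ ⟪u, e⟫ Dφ[ω]`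
(the `e`-component of the vorticity equation is the conservation law `∂ₜω_e = νΔω_e + div(u_e ω − ω_e u)`, tested
against `φ`). [cite: MajdaBertozziCUP2002, Prop. 2.4 eq. (2.110); folklore] -/
theorem hasDerivAt_integral_mul_inner_curl (h : IsClassicalNSSolutionOn S ν 0 u p) (hS : IsOpen S) {t : ℝ}
    (ht : t ∈ S) (e : EuclideanSpace ℝ (Fin 3)) {φ : EuclideanSpace ℝ (Fin 3) → ℝ} (hφ : ContDiff ℝ ∞ φ)
    (hφc : HasCompactSupport φ) :
    HasDerivAt (fun s => ∫ x, φ x * ⟪curl (u s) x, e⟫)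
      (ν * (∫ x, (Δ φ) x * ⟪curl (u t) x, e⟫) +
        (∫ x, ⟪curl (u t) x, e⟫ * fderiv ℝ φ x (u t x)) -
        ∫ x, ⟪u t x, e⟫ * fderiv ℝ φ x (curl (u t) x)) t := by
  have hSu : UniqueDiffOn ℝ S := hS.uniqueDiffOn
  -- smoothness bookkeeping
  have hu : IsSmoothSpaceTimeOn S u := h.smooth_velocity
  have hω : IsSmoothSpaceTimeOn S (vorticity u) := hu.isSmoothSpaceTimeOn_vorticity hSu
  have hΦ : IsSmoothSpaceTimeOn S (fun s x => φ x * ⟪curl (u s) x, e⟫) :=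
    (isSmoothSpaceTimeOn_const_time hφ S).mul (hω.inner (isSmoothSpaceTimeOn_const_time contDiff_const S))
  have hsupp : ∀ s ∈ S, ∀ x ∉ tsupport φ, φ x * ⟪curl (u s) x, e⟫ = 0 := fun s _ x hx => by
    rw [image_eq_zero_of_notMem_tsupport hx, zero_mul]
  have hD := hasDerivAt_integral_of_support_subset (μ := volume) hS hΦ hφc hsupp ht
  -- the slices at time `t`
  have hut : ContDiff ℝ ∞ (u t) := hu.contDiff_slice ht
  have hωt : ContDiff ℝ ∞ (curl (u t)) := hω.contDiff_slice ht
  have hu2 : ContDiff ℝ 2 (u t) := hut.of_le (by norm_cast)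
  have hω2 : ContDiff ℝ 2 (curl (u t)) := hωt.of_le (by norm_cast)
  have hud : Differentiable ℝ (u t) := hu2.differentiable two_ne_zero
  have hωd : Differentiable ℝ (curl (u t)) := hω2.differentiable two_ne_zero
  have hdivu : ∀ x, VectorCalculus.divergence (u t) x = 0 := h.divFree t ht
  have hdivω : ∀ x, VectorCalculus.divergence (curl (u t)) x = 0 := fun x => divergence_curl_eq_zero_holds (u t) hu2 x
  -- the flux `G = ⟪u,e⟫ ω − ⟪ω,e⟫ u`
  set G : EuclideanSpace ℝ (Fin 3) → EuclideanSpace ℝ (Fin 3) := fun y =>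
    ⟪u t y, e⟫ • curl (u t) y - ⟪curl (u t) y, e⟫ • u t y with hG
  have hG1 : ContDiff ℝ 1 G :=
    contDiff_infty.1 (((hut.inner ℝ contDiff_const).smul hωt).sub ((hωt.inner ℝ contDiff_const).smul hut)) 1
  -- the pointwise law at every `x`
  have hpt' : ∀ x, deriv (fun s => φ x * ⟪curl (u s) x, e⟫) t =
      φ x * (ν * ⟪Δ (curl (u t)) x, e⟫ + VectorCalculus.divergence G x) := by
    intro x
    have hvortv := h.vorticity_eq hSu (by rw [hS.interior_eq]; exact subset_closure)
      (fun _ _ y => curl_zero y) ht x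
    rw [timeDerivWithin_eq_deriv hS ht, vorticity_apply] at hvortv
    have hvort : HasDerivAt (fun s => curl (u s) x)
        (ν • Δ (curl (u t)) x - convect (u t) (curl (u t)) x + convect (curl (u t)) (u t) x) t := by
      have hd := hω.hasDerivAt_timeLine hS ht x
      have e0 : (fun s => vorticity u s x) = fun s => curl (u s) x := by
        funext s; rw [vorticity_apply]
      rw [e0] at hvortv hd
      have e1 : deriv (fun s => curl (u s) x) t =
          ν • Δ (curl (u t)) x - convect (u t) (curl (u t)) x + convect (curl (u t)) (u t) x := by
        rw [eq_sub_of_add_eq hvortv]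
        abel
      rwa [e1] at hd
    have hinner : HasDerivAt (fun s => ⟪curl (u s) x, e⟫)
        ⟪ν • Δ (curl (u t)) x - convect (u t) (curl (u t)) x + convect (curl (u t)) (u t) x, e⟫ t := by
      have := hvort.inner ℝ (hasDerivAt_const t e)
      simpa using this
    have hlaw := hinner.const_mul (φ x)
    rw [hlaw.deriv]
    have hflux := inner_convect_sub_eq_divergence (hud x) (hωd x) (hdivu x) (hdivω x) e
    rw [inner_add_left, inner_sub_left, inner_smul_left]
    simp only [RCLike.conj_to_real, hG]
    rw [← hflux]
    ring
  -- continuity / integrability of the densities (everything carries `φ`, `∇φ` or `Δφ`)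
  have hφ1 : ContDiff ℝ 1 φ := contDiff_infty.1 hφ 1
  have hφ2 : ContDiff ℝ 2 φ := contDiff_infty.1 hφ 2
  have hdivc : Continuous (VectorCalculus.divergence G) := continuous_divergence (hG1.continuous_fderiv one_ne_zero)
  have hΔω : Continuous (Δ (curl (u t))) := continuous_laplacian hω2
  have hVc : Continuous fun x => ⟪Δ (curl (u t)) x, e⟫ := hΔω.inner continuous_const
  have hIdiv : Integrable (fun x => φ x * VectorCalculus.divergence G x) :=
    (hφ.continuous.mul hdivc).integrable_of_hasCompactSupport hφc.mul_right
  have hIV : Integrable (fun x => φ x * ⟪Δ (curl (u t)) x, e⟫) :=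
    (hφ.continuous.mul hVc).integrable_of_hasCompactSupport hφc.mul_right
  have hdφc : HasCompactSupport (fderiv ℝ φ) := hφc.fderiv (𝕜 := ℝ)
  have hdφ : Continuous (fderiv ℝ φ) := hφ1.continuous_fderiv one_ne_zero
  have hc₁ : Continuous (fun x => ⟪curl (u t) x, e⟫ * fderiv ℝ φ x (u t x)) :=
    (hωt.continuous.inner continuous_const).mul (hdφ.clm_apply hut.continuous)
  have hc₂ : Continuous (fun x => ⟪u t x, e⟫ * fderiv ℝ φ x (curl (u t) x)) :=
    (hut.continuous.inner continuous_const).mul (hdφ.clm_apply hωt.continuous)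
  have hI₁ : Integrable (fun x => ⟪curl (u t) x, e⟫ * fderiv ℝ φ x (u t x)) := by
    refine hc₁.integrable_of_hasCompactSupport (hdφc.mono fun x hx => ?_)
    simp only [mem_support, ne_eq] at hx ⊢
    intro h0
    exact hx (by rw [h0, _root_.zero_apply, mul_zero])
  have hI₂ : Integrable (fun x => ⟪u t x, e⟫ * fderiv ℝ φ x (curl (u t) x)) := by
    refine hc₂.integrable_of_hasCompactSupport (hdφc.mono fun x hx => ?_)
    simp only [mem_support, ne_eq] at hx ⊢
    intro h0
    exact hx (by rw [h0, _root_.zero_apply, mul_zero])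
  -- integration by parts of the flux against `φ`
  have hibp := integral_mul_divergence_add_eq_zero_left (u := G) hφ1 hG1 hφc
  have hgrad : ∀ v : EuclideanSpace ℝ (Fin 3), ∀ x, ⟪v, gradient φ x⟫ = fderiv ℝ φ x v := fun v x => by
    rw [real_inner_comm, gradient, InnerProductSpace.toDual_symm_apply]
  have hflux : ∫ x, ⟪G x, gradient φ x⟫ =
      (∫ x, ⟪u t x, e⟫ * fderiv ℝ φ x (curl (u t) x)) - ∫ x, ⟪curl (u t) x, e⟫ * fderiv ℝ φ x (u t x) := by
    rw [← integral_sub hI₂ hI₁]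
    refine integral_congr_ae (Eventually.of_forall fun x => ?_)
    beta_reduce
    rw [hgrad]
    simp only [hG, map_sub, map_smul, smul_eq_mul]
  -- Green's second identity for the viscous term
  have hvisc : ∫ x, φ x * ⟪Δ (curl (u t)) x, e⟫ = ∫ x, (Δ φ) x * ⟪curl (u t) x, e⟫ :=
    integral_mul_inner_laplacian_eq hω2 hφ2 hφc e
  -- assemble
  refine hD.congr_deriv ?_
  calc ∫ x, deriv (fun s => φ x * ⟪curl (u s) x, e⟫) t
      = ∫ x, (ν * (φ x * ⟪Δ (curl (u t)) x, e⟫) + φ x * VectorCalculus.divergence G x) := by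
        refine integral_congr_ae (Eventually.of_forall fun x => ?_)
        simp only [hpt' x]
        ring
    _ = ν * (∫ x, φ x * ⟪Δ (curl (u t)) x, e⟫) + ∫ x, φ x * VectorCalculus.divergence G x := by
        rw [integral_add (hIV.const_mul ν) hIdiv, integral_const_mul]
    _ = _ := by
        rw [show (∫ x, φ x * VectorCalculus.divergence G x) = -∫ x, ⟪G x, gradient φ x⟫ by linarith, hflux, hvisc]
        ring

/-- **The balance law for the door's Type-I ancient Oseen-mild class.**  Every profile `v` of the route's class (Type-I
rate `C`, continuity on the open slab, unit-viscosity Oseen–Duhamel identity, divergence-free slices) is classical on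
`(−∞,0)`, so for every `t < 0`, direction `e` and test function `φ ∈ C_c^∞(ℝ³)`:
`d/dt ∫ φ ⟪curl v, e⟫ = ∫ (Δφ) ⟪curl v, e⟫ + ∫ ⟪curl v, e⟫ Dφ[v] − ∫ ⟪v, e⟫ Dφ[curl v]` at `t`.
[cite: MajdaBertozziCUP2002, Prop. 2.4 eq. (2.110); folklore] -/
theorem hasDerivAt_integral_mul_inner_curl_of_class :
    ∀ (C : ℝ) (v : ℝ → EuclideanSpace ℝ (Fin 3) → EuclideanSpace ℝ (Fin 3)),
    Literature.Analysis.FluidPDE.HasTypeITimeDecay C v →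
    ContinuousOn (Function.uncurry v) (Set.Iio (0 : ℝ) ×ˢ Set.univ) →
    (∀ s t : ℝ, s < t → t < 0 → ∀ x, v t x =
      Literature.Analysis.UnboundedOperators.heatExtension (v s) (t - s) x -
        Literature.Analysis.FluidPDE.oseenDuhamel 1 s v v t x) →
    (∀ t < 0, Literature.Analysis.FluidPDE.VectorCalculus.IsDivFree (v t)) →
    ∀ t < 0, ∀ (e : EuclideanSpace ℝ (Fin 3)) (φ : EuclideanSpace ℝ (Fin 3) → ℝ), ContDiff ℝ ∞ φ → HasCompactSupport φ →
      HasDerivAt (fun s => ∫ x, φ x * ⟪Literature.Analysis.FluidPDE.curl (v s) x, e⟫_ℝ)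
        ((∫ x, (Δ φ) x * ⟪Literature.Analysis.FluidPDE.curl (v t) x, e⟫_ℝ) +
          (∫ x, ⟪Literature.Analysis.FluidPDE.curl (v t) x, e⟫_ℝ * fderiv ℝ φ x (v t x)) -
          ∫ x, ⟪v t x, e⟫_ℝ * fderiv ℝ φ x (Literature.Analysis.FluidPDE.curl (v t) x)) t := by
  intro C v hrate hcont hmild hdiv t ht e φ hφ hφc
  obtain ⟨q, hcl⟩ := exists_classical_of_class hrate hcont hmild hdiv
  have h := hasDerivAt_integral_mul_inner_curl hcl isOpen_Iio ht e hφ hφc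
  rwa [one_mul] at h

end Summit.NavierStokesRegularity.NavierStokesRegularity.Theorems.HalfSpaceWindowDoorCirculationCarryingRigidityVorticityBalance

end
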